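import Summits.NavierStokesRegularity.NavierStokesRegularity.Theses.RellichScar
import Literature.Analysis.FluidPDE.ParasiticSlabFlow
import Literature.Analysis.FluidPDE.LocalTypeISlabProfile

/-!
# `ApexLocalisation` (crux stmt-NavierStokesRegularity-11719, route RellichScar): logical position and
# load-bearing hypotheses — negative-side support (cdisprove seat, gen 2)

Sorry-free lemmas of the standing disprover of
`Summit.NavierStokesRegularity.NavierStokesRegularity.Theses.RellichScar.ApexLocalisation`
("a rate-Type-I singular slab profile with `𝐈 < ⊤` yields an apex (space–time Type-I) singular
profile"), extracted from its work file `Cruxes/ApexLocalisation/Disproof.lean` so that ideators,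
planners and provers can IMPORT them:

* §0 the two classes `IsRateProfile` / `IsApexProfile` (verbatim conjuncts of the crux) and the two
  existence statements; apex ⊆ rate;
* §1 LOGICAL POSITION: `ApexLocalisation ↔ (RateProfileExists → ApexProfileExists)`,
  `¬ ApexLocalisation ↔ RateProfileExists ∧ NoApexTypeIProfile` (a refutation must exhibit a
  Type-I blow-up profile AND prove the route target), `ApexLocalisation ∨ NoApexTypeIProfile`,
  `¬ RateProfileExists (= stmt-1588 verbatim) ↔ NoApexTypeIProfile ∧ ApexLocalisation`, the two horns;
* §1b versus Albritton–Barker's first bullet (`LocalTypeISingularityExists`, registered OPEN, via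
  the Literature bridge `localTypeISingularityExists_of_slabProfile`):
  `¬ ApexLocalisation → LocalTypeISingularityExists`, `¬ LocalTypeISingularityExists → ¬RateProfileExists ∧ X ∧ crux`;
* §2 LOAD-BEARING: with `𝐈 < ⊤` (resp. the singular origin) dropped from the antecedent the crux is
  EQUIVALENT to `¬ NoApexTypeIProfile` (witnesses: the parasitic flow of `ParasiticSlabFlow`, resp.
  the zero flow) — `apexLocalisation_false_without_I`, `apexLocalisation_false_without_Sing`; every
  rate profile has `0 < C`.

## References

* D. Albritton, T. Barker, J. Math. Fluid Mech. 21 (2019) = arXiv:1811.00502, §1, Thm 1.1. [AlbrittonBarker2019]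
* G. Koch, N. Nadirashvili, G. Seregin, V. Šverák, Acta Math. 203 (2009), §1 (parasitic solutions; (1.4), (1.6)). [KNSS2009]
-/

noncomputable section

open MeasureTheory TopologicalSpace Set Function Filter Topology Metric
open scoped InnerProductSpace RealInnerProductSpace ENNReal NNReal
open Literature.Analysis.FluidPDE
open Summit.NavierStokesRegularity.NavierStokesRegularity.Theses

set_option linter.dupNamespace false

namespace Summit.NavierStokesRegularity.NavierStokesRegularity.Theorems.ApexLocalisation.Negative

/-- Physical space. -/
local notation "ℝ³" => EuclideanSpace ℝ (Fin 3)

/-- The open backward slab `(-∞,0) × ℝ³` (time first), as in the route file. -/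
local notation "𝕊" => Literature.Analysis.FluidPDE.slab (EuclideanSpace ℝ (Fin 3)) (Set.Iio (0 : ℝ)) isOpen_Iio

/-! ## §0 The two classes -/

/-- The ANTECEDENT class of the crux: a rate-Type-I singular slab profile with constant `C`
(suitable weak on the slab, weak gradient `G`, `𝐈(ℝ³ × ℝ₋) < ⊤`, `‖u‖ ≤ C/√(−t)`, origin
backward-singular) — verbatim the conjuncts of `ApexLocalisation`'s hypothesis. -/
def IsRateProfile (C : ℝ) (u : ℝ → ℝ³ → ℝ³) (p : ℝ → ℝ³ → ℝ) (G : ℝ → ℝ³ → ℝ³ →L[ℝ] ℝ³) : Prop :=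
  IsSuitableWeakSolutionOn 𝕊 1 0 u p ∧ HasWeakSpatialGradientOn 𝕊 u G ∧
    typeIBound (Set.Iio (0 : ℝ) ×ˢ Set.univ) u p G < ⊤ ∧ HasTypeITimeDecay C u ∧
      IsBackwardSingularPoint u 0

/-- The CONCLUSION class of the crux (= hypothesis class of the target `NoApexTypeIProfile`):
an apex profile, `‖u‖ ≤ C/(‖x‖ + √(−t))`. -/
def IsApexProfile (C : ℝ) (u : ℝ → ℝ³ → ℝ³) (p : ℝ → ℝ³ → ℝ) (G : ℝ → ℝ³ → ℝ³ →L[ℝ] ℝ³) : Prop :=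
  IsSuitableWeakSolutionOn 𝕊 1 0 u p ∧ HasWeakSpatialGradientOn 𝕊 u G ∧
    typeIBound (Set.Iio (0 : ℝ) ×ˢ Set.univ) u p G < ⊤ ∧ HasTypeIDecay C u ∧
      IsBackwardSingularPoint u 0

/-- "Some rate-Type-I singular profile exists" (= ¬ stmt-1588). -/
def RateProfileExists : Prop :=
  ∃ (C : ℝ) (u : ℝ → ℝ³ → ℝ³) (p : ℝ → ℝ³ → ℝ) (G : ℝ → ℝ³ → ℝ³ →L[ℝ] ℝ³), IsRateProfile C u p G

/-- "Some apex singular profile exists" (= ¬ X). -/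
def ApexProfileExists : Prop :=
  ∃ (C : ℝ) (u : ℝ → ℝ³ → ℝ³) (p : ℝ → ℝ³ → ℝ) (G : ℝ → ℝ³ → ℝ³ →L[ℝ] ℝ³), IsApexProfile C u p G

variable {C : ℝ} {u : ℝ → ℝ³ → ℝ³} {p : ℝ → ℝ³ → ℝ} {G : ℝ → ℝ³ → ℝ³ →L[ℝ] ℝ³}

/-- Apex profiles are rate profiles with the same constant (`0 ≤ C` is forced by the apex
bound at `x = 0`). -/
theorem IsApexProfile.isRateProfile (h : IsApexProfile C u p G) : IsRateProfile C u p G :=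
  ⟨h.1, h.2.1, h.2.2.1, h.2.2.2.1.hasTypeITimeDecay (nonneg_of_hasTypeIDecay h.2.2.2.1), h.2.2.2.2⟩

/-- Hence `ApexProfileExists → RateProfileExists`. -/
theorem rateProfileExists_of_apexProfileExists (h : ApexProfileExists) : RateProfileExists := by
  obtain ⟨C, u, p, G, h⟩ := h
  exact ⟨C, u, p, G, h.isRateProfile⟩

/-! ## §1 Logical position of the crux -/

/-- The crux, uncurried: `ApexLocalisation ↔ (RateProfileExists → ApexProfileExists)`. -/
theorem apexLocalisation_iff :
    RellichScar.ApexLocalisation ↔ (RateProfileExists → ApexProfileExists) := by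
  constructor
  · rintro h ⟨C, u, p, G, hr⟩
    obtain ⟨C', u', p', G', h'⟩ := h C ⟨u, p, G, hr⟩
    exact ⟨C', u', p', G', h'⟩
  · rintro h C ⟨u, p, G, hr⟩
    obtain ⟨C', u', p', G', h'⟩ := h ⟨C, u, p, G, hr⟩
    exact ⟨C', u', p', G', h'⟩

/-- The route target X says the conclusion class is empty. -/
theorem noApexTypeIProfile_iff : RellichScar.NoApexTypeIProfile ↔ ¬ ApexProfileExists := by
  constructor
  · rintro h ⟨C, u, p, G, hs, hg, hI, hd, hsing⟩
    exact h u p G C hs hg hI hd hsing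
  · intro h u p G C hs hg hI hd hsing
    exact h ⟨C, u, p, G, hs, hg, hI, hd, hsing⟩

/-- **What a disproof must do.** `¬ ApexLocalisation ↔ RateProfileExists ∧ X`: exhibit a
rate-Type-I singular profile (a Type-I blow-up model of 3-D Navier–Stokes — open; none under
the Liouville conjecture (L) of KNSS 2009) AND prove the route target. -/
theorem not_apexLocalisation_iff :
    ¬ RellichScar.ApexLocalisation ↔ (RateProfileExists ∧ RellichScar.NoApexTypeIProfile) := by
  rw [apexLocalisation_iff, noApexTypeIProfile_iff]
  tauto

/-- The crux and the target cannot both fail: `ApexLocalisation ∨ X`. -/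
theorem apexLocalisation_or_target :
    RellichScar.ApexLocalisation ∨ RellichScar.NoApexTypeIProfile := by
  by_contra h
  push Not at h
  exact h.2 (not_apexLocalisation_iff.1 h.1).2

/-- Horn 1: the crux follows from the emptiness of the antecedent class (`¬ RateProfileExists` is
verbatim RecurrentProfiles' target `NoTypeIRateProfile`, stmt-1588; this is the situation under (L)). -/
theorem apexLocalisation_of_not_rateProfileExists (h : ¬ RateProfileExists) :
    RellichScar.ApexLocalisation :=
  apexLocalisation_iff.2 fun hr => absurd hr h

/-- Horn 2: the crux follows from the existence of ANY apex profile (¬ X). -/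
theorem apexLocalisation_of_apexProfileExists (h : ApexProfileExists) :
    RellichScar.ApexLocalisation :=
  apexLocalisation_iff.2 fun _ => h

/-- Horn 2, target form: `¬ X → ApexLocalisation`. -/
theorem apexLocalisation_of_not_target (h : ¬ RellichScar.NoApexTypeIProfile) :
    RellichScar.ApexLocalisation :=
  apexLocalisation_of_apexProfileExists (by rwa [noApexTypeIProfile_iff, not_not] at h)

/-- "No rate profile" (= stmt-1588) is exactly target + crux: `¬ RateProfileExists ↔ X ∧ ApexLocalisation`
— the crux is the precise gap between the RATE form and the APEX form of "no Type-I profile". -/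
theorem not_rateProfileExists_iff_target_and_crux :
    ¬ RateProfileExists ↔ (RellichScar.NoApexTypeIProfile ∧ RellichScar.ApexLocalisation) := by
  rw [noApexTypeIProfile_iff, apexLocalisation_iff]
  constructor
  · intro h
    exact ⟨fun ha => h (rateProfileExists_of_apexProfileExists ha), fun hr => absurd hr h⟩
  · rintro ⟨hX, hloc⟩ hr
    exact hX (hloc hr)

/-- Symmetric form: since apex ⊆ rate, the crux says the two existence questions coincide. -/
theorem apexLocalisation_iff_exists_iff :
    RellichScar.ApexLocalisation ↔ (RateProfileExists ↔ ApexProfileExists) := by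
  rw [apexLocalisation_iff]
  exact ⟨fun h => ⟨h, rateProfileExists_of_apexProfileExists⟩, fun h => h.1⟩

/-- Under `RateProfileExists` the crux is literally `¬ X`; under `¬ RateProfileExists` it is
true. So its truth value is undetermined exactly in the world "Type-I blow-up exists". -/
theorem apexLocalisation_iff_not_target_of_rateProfileExists (hr : RateProfileExists) :
    RellichScar.ApexLocalisation ↔ ¬ RellichScar.NoApexTypeIProfile := by
  rw [apexLocalisation_iff, noApexTypeIProfile_iff, not_not]
  exact ⟨fun h => h hr, fun h _ => h⟩

/-- A disproof of the crux exhibits a rate profile (refuting stmt-1588 and every Liouville-type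
statement implying it). -/
theorem rateProfileExists_of_not_apexLocalisation (h : ¬ RellichScar.ApexLocalisation) :
    RateProfileExists :=
  (not_apexLocalisation_iff.1 h).1

/-! ## §1b The (L)-world: the crux versus Albritton–Barker's first bullet

By the packaging theorem `Literature.Analysis.FluidPDE.localTypeISingularityExists_of_slabProfile`
(`LocalTypeISlabProfile.lean`, landed by the sibling disprover of `SymmetricScarExists`; see also its
`Theorems/SymmetricScarExists/Negative/LocalTypeIBarrier.lean`), every rate profile is a local Type I
singular point in the PRINTED sense of Albritton–Barker 2019 (Thm 1.1, first bullet =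
`LocalTypeISingularityExists`, a registered OPEN statement, expected false under the KNSS Liouville
conjecture (L)). Hence: a disproof of the crux is a CONSTRUCTION of a Type-I singularity of 3-D
Navier–Stokes, and `¬ LocalTypeISingularityExists` proves the crux (and X, and stmt-1588) outright. -/

/-- Every rate profile witnesses A–B's first bullet. -/
theorem IsRateProfile.localTypeISingularityExists (h : IsRateProfile C u p G) :
    LocalTypeISingularityExists :=
  localTypeISingularityExists_of_slabProfile h.1 h.2.1 h.2.2.1 h.2.2.2.2

/-- `RateProfileExists → LocalTypeISingularityExists`. -/
theorem localTypeISingularityExists_of_rateProfileExists (h : RateProfileExists) :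
    LocalTypeISingularityExists := by
  obtain ⟨C, u, p, G, h⟩ := h
  exact h.localTypeISingularityExists

/-- **A disproof of the crux settles A–B's open first bullet POSITIVELY** (exhibits a suitable weak
solution with a Type I singular point). -/
theorem localTypeISingularityExists_of_not_apexLocalisation (h : ¬ RellichScar.ApexLocalisation) :
    LocalTypeISingularityExists :=
  localTypeISingularityExists_of_rateProfileExists (not_apexLocalisation_iff.1 h).1

/-- **"No Type-I singular point" proves the crux** (vacuously: the antecedent class is empty), and
with it stmt-1588 and the target X. This is the precise sense of "true under (L)": A–B Thm 1.1 +
(L) refute `LocalTypeISingularityExists` up to the tree's measurability proviso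
(`LocalTypeILiouville.lean`). -/
theorem apexLocalisation_of_not_localTypeISingularityExists (hno : ¬ LocalTypeISingularityExists) :
    RellichScar.ApexLocalisation :=
  apexLocalisation_of_not_rateProfileExists
    fun hr => hno (localTypeISingularityExists_of_rateProfileExists hr)

/-- ... packaged: `¬ LocalTypeISingularityExists → ¬ RateProfileExists ∧ X ∧ ApexLocalisation`. -/
theorem all_of_not_localTypeISingularityExists (hno : ¬ LocalTypeISingularityExists) :
    ¬ RateProfileExists ∧ RellichScar.NoApexTypeIProfile ∧ RellichScar.ApexLocalisation := by
  have h1588 : ¬ RateProfileExists :=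
    fun hr => hno (localTypeISingularityExists_of_rateProfileExists hr)
  exact ⟨h1588, (not_rateProfileExists_iff_target_and_crux.1 h1588).1,
    (not_rateProfileExists_iff_target_and_crux.1 h1588).2⟩

/-! ## §2 Load-bearing hypotheses and constants -/

/-- Every rate profile has a POSITIVE constant: for `C ≤ 0` the rate bound forces `u = 0` on the
slab pointwise, contradicting the singular origin. (The `∀ C` of the crux is vacuous for `C ≤ 0`.) -/
theorem IsRateProfile.pos (h : IsRateProfile C u p G) : 0 < C := by
  by_contra hC
  push Not at hC
  have hzero : ∀ t < 0, ∀ x, u t x = 0 := fun t ht x => by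
    have h1 := h.2.2.2.1 t ht x
    have h2 : C / Real.sqrt (-t) ≤ 0 := div_nonpos_of_nonpos_of_nonneg hC (Real.sqrt_nonneg _)
    exact norm_le_zero_iff.1 (h1.trans h2)
  have hae : uncurry u =ᵐ[volume.restrict (parabolicCylinder 1 (0 : ℝ × ℝ³))] 0 := by
    refine ae_restrict_of_forall_mem (isOpen_parabolicCylinder 1 _).measurableSet ?_
    rintro ⟨t, x⟩ hz
    rw [mem_parabolicCylinder] at hz
    have ht : t < 0 := by simpa using hz.1.2
    simpa using hzero t ht x
  have hs := h.2.2.2.2 1 one_pos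
  rw [eLpNorm_congr_ae hae, eLpNorm_zero] at hs
  exact ENNReal.zero_ne_top hs

/-- Apex profiles, too, have `0 < C`. -/
theorem IsApexProfile.pos (h : IsApexProfile C u p G) : 0 < C :=
  h.isRateProfile.pos

/-- The crux with `𝐈 < ⊤` DROPPED from the antecedent (conclusion verbatim). -/
def ApexLocalisationWithoutI : Prop :=
  ∀ C : ℝ, (∃ (u : ℝ → ℝ³ → ℝ³) (p : ℝ → ℝ³ → ℝ) (G : ℝ → ℝ³ → ℝ³ →L[ℝ] ℝ³),
    IsSuitableWeakSolutionOn 𝕊 1 0 u p ∧ HasWeakSpatialGradientOn 𝕊 u G ∧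
      HasTypeITimeDecay C u ∧ IsBackwardSingularPoint u 0) → ApexProfileExists

/-- The antecedent without `𝐈 < ⊤` IS inhabited, by an honest smooth Navier–Stokes solution: the
parasitic flow `u = e₀/√(−t)`, `p = −b′(t)⟨e₀,x⟩` (KNSS 2009 §1; library `ParasiticSlabFlow`,
gen-1 disprover, p68502). It has `𝐈 = ⊤` (`parasitic_typeIBound_eq_top`). -/
theorem withoutI_antecedent_inhabited :
    ∃ (C : ℝ) (u : ℝ → ℝ³ → ℝ³) (p : ℝ → ℝ³ → ℝ) (G : ℝ → ℝ³ → ℝ³ →L[ℝ] ℝ³),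
      IsSuitableWeakSolutionOn 𝕊 1 0 u p ∧ HasWeakSpatialGradientOn 𝕊 u G ∧
        HasTypeITimeDecay C u ∧ IsBackwardSingularPoint u 0 :=
  ⟨1, parasiticVelocity 1, parasiticPressure 1, _, parasitic_isSuitableWeakSolutionOn 1,
    parasitic_hasWeakSpatialGradientOn 1, parasitic_hasTypeITimeDecay zero_le_one,
    parasitic_isBackwardSingularPoint_zero one_pos⟩

/-- **`𝐈 < ⊤` is load-bearing**: without it the crux is equivalent to `¬ X` (so, inside this
route, unprovable — it would sink the target). Any proof must use `𝐈 < ⊤` of the GIVEN profile. -/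
theorem apexLocalisationWithoutI_iff_not_target :
    ApexLocalisationWithoutI ↔ ¬ RellichScar.NoApexTypeIProfile := by
  rw [noApexTypeIProfile_iff, not_not]
  constructor
  · intro h
    obtain ⟨C, u, p, G, hw⟩ := withoutI_antecedent_inhabited
    exact h C ⟨u, p, G, hw⟩
  · intro h C _
    exact h

/-- `_false_without_` form: granted the route target X, the `𝐈`-less crux is false. -/
theorem apexLocalisation_false_without_I (hX : RellichScar.NoApexTypeIProfile) :
    ¬ ApexLocalisationWithoutI :=
  fun h => (apexLocalisationWithoutI_iff_not_target.1 h) hX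

/-- The crux with the SINGULAR ORIGIN dropped from the antecedent. -/
def ApexLocalisationWithoutSing : Prop :=
  ∀ C : ℝ, (∃ (u : ℝ → ℝ³ → ℝ³) (p : ℝ → ℝ³ → ℝ) (G : ℝ → ℝ³ → ℝ³ →L[ℝ] ℝ³),
    IsSuitableWeakSolutionOn 𝕊 1 0 u p ∧ HasWeakSpatialGradientOn 𝕊 u G ∧
      typeIBound (Set.Iio (0 : ℝ) ×ˢ Set.univ) u p G < ⊤ ∧ HasTypeITimeDecay C u) →
    ApexProfileExists

/-- The parasitic flow with `C = 0` is the zero flow. -/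
theorem parasiticVelocity_zero : parasiticVelocity 0 = 0 := by
  funext t x
  simp [parasiticVelocity, parasiticAmp]

/-- ... with zero pressure. -/
theorem parasiticPressure_zero : parasiticPressure 0 = 0 := by
  have hamp : parasiticAmp 0 = fun _ => 0 := by
    funext t
    simp [parasiticAmp]
  funext t x
  simp [parasiticPressure, hamp]

/-- The antecedent without the singular origin is inhabited by the zero flow (`𝐈 = 0`,
`typeIBound_zero`), at `C = 0`. -/
theorem withoutSing_antecedent_inhabited :
    ∃ (u : ℝ → ℝ³ → ℝ³) (p : ℝ → ℝ³ → ℝ) (G : ℝ → ℝ³ → ℝ³ →L[ℝ] ℝ³),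
      IsSuitableWeakSolutionOn 𝕊 1 0 u p ∧ HasWeakSpatialGradientOn 𝕊 u G ∧
        typeIBound (Set.Iio (0 : ℝ) ×ˢ Set.univ) u p G < ⊤ ∧ HasTypeITimeDecay 0 u := by
  have hs := parasitic_isSuitableWeakSolutionOn 0
  have hg := parasitic_hasWeakSpatialGradientOn 0
  rw [parasiticVelocity_zero] at hs hg
  rw [parasiticPressure_zero] at hs
  have hG : (fun (t : ℝ) (x : ℝ³) => fderiv ℝ ((0 : ℝ → ℝ³ → ℝ³) t) x) = 0 := by
    funext t x
    simp
  rw [hG] at hg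
  refine ⟨0, 0, 0, hs, hg, ?_, fun t _ x => by simp⟩
  rw [typeIBound_zero]
  exact ENNReal.zero_lt_top

/-- **The singular origin is load-bearing**: without it the crux is again `¬ X`. -/
theorem apexLocalisationWithoutSing_iff_not_target :
    ApexLocalisationWithoutSing ↔ ¬ RellichScar.NoApexTypeIProfile := by
  rw [noApexTypeIProfile_iff, not_not]
  constructor
  · intro h
    exact h 0 withoutSing_antecedent_inhabited
  · intro h C _
    exact h

/-- `_false_without_` form for the singular origin. -/
theorem apexLocalisation_false_without_Sing (hX : RellichScar.NoApexTypeIProfile) :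
    ¬ ApexLocalisationWithoutSing :=
  fun h => (apexLocalisationWithoutSing_iff_not_target.1 h) hX

/-- The crux with the RATE dropped from the antecedent: antecedent = "an Albritton–Barker-type
Type-I singular slab solution exists" (open both ways). This is STRONGER than the crux; recorded
to make the monotonicity explicit (no cheap model: its antecedent is as uninhabitable today as the
crux's). -/
def ApexLocalisationWithoutRate : Prop :=
  (∃ (u : ℝ → ℝ³ → ℝ³) (p : ℝ → ℝ³ → ℝ) (G : ℝ → ℝ³ → ℝ³ →L[ℝ] ℝ³),
    IsSuitableWeakSolutionOn 𝕊 1 0 u p ∧ HasWeakSpatialGradientOn 𝕊 u G ∧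
      typeIBound (Set.Iio (0 : ℝ) ×ˢ Set.univ) u p G < ⊤ ∧ IsBackwardSingularPoint u 0) →
    ApexProfileExists

/-- Dropping the rate strengthens the crux. -/
theorem apexLocalisation_of_withoutRate (h : ApexLocalisationWithoutRate) :
    RellichScar.ApexLocalisation :=
  apexLocalisation_iff.2 fun ⟨_, u, p, G, hs, hg, hI, _, hsing⟩ => h ⟨u, p, G, hs, hg, hI, hsing⟩


end Summit.NavierStokesRegularity.NavierStokesRegularity.Theorems.ApexLocalisation.Negative
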